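import Summits.QuantumFields.YangMills.Theorems.BalabanUVNodesN17AtRecord12

/-!
# BalabanUVNodes ∕ node N17 = NE4 — WHAT THE ∃-READING CUT OF K3′ (`SpineGivenEndpointR12`, rev 15; BC3 skeleton v2 `K3Skeleton12.lean` sha16 577f0c1f40d34c78,
# registered stubs `stub_rates12` ∕ `stub_expansion12`) OBLIGES, READ THROUGH ITS N17 CONJUNCT

Cell `pub-ymgap`, HUMAN RULING D-0062, seat `pub-ymgap-dag-n17-c` (R134 fan-out, strategy s2 = BY-NAME KNIT AT THE RECORD), generation 4; companion 17 of
`BalabanUVNodesN17Knit` … `…N17AtRecord12` (p462063) ∕ `…N17AtRecord12Keys` (p466348) ∕ `…N17AtRateRecord12` (p466667).  THEOREMS ONLY (0 `def`); imports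
companion 13 `…N17AtRecord12` (hence module 2's `YMDAG.UVSplit.RatesAt ∕ N14At … N22At ∕ U3Carriers ∕ RateCarriers ∕ SpineCarriers` and def-T's `Node00/Record12`);
modifies nothing; NO `Theses` import and NO import of the skeleton — the skeleton's hypothesis shapes

* `RateReading N := (F : T4Family) → (θ : Stage12Params F N) → θ.Provisos₁₂ F N → (ℕ → ℝ) → List (ULoop F) → RateCarriers N` (and `SpineReading N`, valued in
  `SpineCarriers`),
* `KeyedRates rr := ∀ F θ hP, θ.Admissible F N → ∀ g₀ os, RatesAt (datumOfRecord₁₂ F N θ hP) (rr F θ hP g₀ os)`,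
* `KeyedWindow rr := ∀ F θ hP g₀ os, (rr F θ hP g₀ os).u3.γ = θ.γ`,
* `KeyedCoreEdge cr rr := ∀ F θ hP, θ.Admissible F N → ∀ g₀ os, RatesAt (datumOfRecord₁₂ F N θ hP) (rr F θ hP g₀ os) → letI := (cr …).dec;
   ∃ δ, NE7.Core (cr …).l₀ (cr …).vol (cr …).T (cr …).Bad (A − shA) (B − shB) δ ∧ Summable δ`

are written out UNFOLDED below, at the tree's generality `N` (`[NeZero N]`), so that the K3′ line instantiates every theorem here at `N = 2` by `exact` (delta).

THE POINT (kernel facts about HYPOTHESIS SHAPES; nothing of Bałaban's is asserted or refuted).  `stub_rates12 : ∃ rr : RateReading 2, KeyedRates rr ∧ KeyedWindow rr`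
quantifies EXISTENTIALLY over the reading, and `RatesAt D R := N14At R.ne1 ∧ N15At R.ne2 ∧ N16At R.ne3 ∧ N17At D R.u3 ∧ N18At R.u3 ∧ N22At R.u3` constrains the
LETTERS of the carriers `R` by nothing but the six node shapes themselves.  Five of the six shapes are inhabited by LETTER-DEGENERATE carriers carrying no
estimate (§A: the dressed tower over `Empty`; the paired-instance family over `PEmpty` — n15-a's A2 trap `exists_reading_s_N15_rRec₁₂_vacuous` is this corner;
`dom := ∅`; the coupling window `W := ∅` with zero history moduli — (D4) `ReadOutAt`, which forces the box histories INTO `W`, is the SEPARATE binder `S_D4`, not a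
conjunct of `RatesAt`).  The sixth, N17, reads the DATUM: `N17At D u := NE4OnData D (u.cr·u.C₅·u.θ) u.ρ u.γ`, and with the window pinned (`u.γ = θ.γ > 0`) it cannot
be emptied — but its letters `c := cr·C₅·θ` and `ρ` are FREE (no sign law, no `ρ < 1`).  Hence, in the kernel:

* §B `exists_ratesAt_window_iff_n17Free`: `(∃ R, RatesAt D R ∧ R.u3.γ = γ) ↔ ∃ c ρ, NE4OnData D c ρ γ`;
* §C **`exists_keyedRatesWindow₁₂_iff_n17Free`**: the LITERAL shape of `stub_rates12` `↔ ∀ F θ (hP : θ.Provisos₁₂ F N), θ.Admissible F N → ∃ c ρ,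
  NE4OnData (datumOfRecord₁₂ F N θ hP) c ρ θ.γ` =: «N17 WITH FREE LETTERS AT THE RECORD»;
* §D in β-of-record words (`n17Free₁₂_iff_merged`, `_iff_betaOfRecord₁₀`): at every admissible Stage-12 tuple the continuous-version merged β of record `βmT(θ)`
  satisfies SOME bound `|β_{k+2}(w) − β_{k+1}(tail w)| ≤ c·ρ^k` on `]0, θ.γ]^{k+2}`, `c, ρ` free — a statement with content (no kernel inhabitant is known: `βmT` is
  built from `Node00.polLimit` values) but NOT N17's DECAY: §E `scaleShiftRate_of_absBound` — free letters are bought by any GROWTH bound `|β_{k+1}| ≤ M·A^k`, `A ≥ 1`;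
* §F **`forall_keyedRates₁₂_imp_iff_rateFree`**: GIVEN §C's right-hand side, the LITERAL shape of `stub_expansion12` (its three `rr`-free conjuncts as generic
  predicates `P₁ P₂ P₃` on spine readings) `↔ ∃ cr, P₁ cr ∧ P₂ cr ∧ P₃ cr ∧` the core edge WITHOUT its `RatesAt` antecedent — because the `∀ rr` must also serve
  §C's letter-degenerate reading, at which the antecedent is TRUE; **`k3Cut₁₂_iff_n17Free_and_rateFree`**: stub 1 ∧ stub 2 `↔` «N17 free» ∧ that rate-free package.

ONE-LINE DIAGNOSIS (evidence for plan g64 ∕ the K3′ line ∕ ref-D WATCH-N27-KEYED-INSTANCE; the repair is the planner's): in the v2 ∃-reading cut the K4 cluster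
N14 ∕ N15 ∕ N16 ∕ N18 ∕ N22 is IDLE and N17 enters only with free letters; every rate a `stub_expansion12` prover could use is erased by the `∀ rr` — the skeleton's
own caveat «N19′'s `δ` is not a NAMED function of the rate letters» made quantitative.  Natural repairs (none typed here): cut stub 1 at a NAMED reading of record
(the (T-RATE)₁₂ home `rateCarriersOfRecord₁₂ 𝔯` with RR-1's populated ∕ pinned displays); or carry (D4) `ReadOutAt D R.u3`, `R.u3.ρ < 1`, populated indices and a
nonempty `dom` INSIDE the keyed rates; or make `δ` and the K5 constants named functions of the rate letters.

HONEST FRAMING.  Kernel bookkeeping about hypothesis SHAPES; 0 sorry; NE4 NOT IN PRINT ([Balaban1987RG1] (1.20)–(1.22) p. 264, p. 298) and NOT PROVED; the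
letter-degenerate carriers are DISPLAYED as such and discharge NO node (they are the corners the (W2) populatedness displays of RR-1 ∕ n14-a ∕ n15-a exclude);
nothing of Bałaban's asserted; N17 = composite (max of N15, N16, (D4)), NOT discharged; K3′ NOT claimed and NOT refuted; «A: n∕28» unmoved.  One finite
four-torus at fixed ε per run — NOT infinite volume, NOT OS on ℝ⁴, NOT a mass gap, NOT Clay.
-/

noncomputable section

open scoped Matrix.Norms.L2Operator

namespace Summit.QuantumFields.YangMills.Theorems.BalabanUVNodesN17

open Literature.MathematicalPhysics.QuantumFieldTheory.Balaban1983to89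
open Literature.MathematicalPhysics.QuantumFieldTheory.Balaban1983to89.FlowStep
open Literature.MathematicalPhysics.QuantumFieldTheory.Balaban1983to89.T4CouplingMatching
open Literature.MathematicalPhysics.QuantumFieldTheory.Balaban1983to89.T4Continuum (T4Family FiniteEpsData ULoop)
open Literature.MathematicalPhysics.QuantumFieldTheory.Balaban1983to89.Node00
open Summit.QuantumFields.BalabanUV.T4Continuum.Spine
open Summit.QuantumFields.BalabanUV.T4Continuum.Spine.NE4 (NE4OnData ne4OnData_iff)
open YMDAG.UVSplit (Datum U3Carriers RateCarriers SpineCarriers NE1pCarriers NE2Carriers NE3Carriers N17At N14At N15At N16At N18At N22At RatesAt)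

/-! ## §A THE FIVE NON-N17 CONJUNCTS OF `RatesAt` ARE INHABITED BY LETTER-DEGENERATE CARRIERS (no estimate; displayed as such) -/

section Degenerate

variable {N : ℕ}

/-- **N14 · the dressed tower over `Empty`** has `DressedStabilityStrict` with `A₀ = ρ₁ = τ = 0`, `Λ = 0`, `r = 1∕2` (the `∀ p K` class clause is vacuous; n14-a's
`n14At_toyTower` is a NON-degenerate toy — this is the EMPTY one). [bookkeeping] -/
theorem n14At_emptyTower : N14At ⟨Empty, ⟨fun q => q.elim, fun q => q.elim, fun q => q.elim⟩, 0⟩ :=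
  ⟨0, 0, 0, 1 / 2, ⟨le_rfl, le_rfl, le_rfl, zero_le_one, fun p => p.elim⟩, le_rfl, by norm_num, by norm_num⟩

/-- **N15 · the paired-instance family over `PEmpty`** has all three NE2⁺ layers with positive constants and a vacuous `∀ i` (n15-a's A2 trap
`N15.AtRateRecord12.exists_reading_s_N15_rRec₁₂_vacuous` is this corner, the one RR-1's `Populated` display excludes). [bookkeeping] -/
theorem n15At_emptyIndex :
    N15At { I := PEmpty, c35 := 0, p := 0, pi := PEmpty.elim, Kop := fun i => i.elim, Ksite := fun i => i.elim, Kunit := fun i => i.elim,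
            inΛ := fun i => i.elim, unitDist := fun i => i.elim } :=
  ⟨⟨1, 1, 1, 1, 1, one_pos, one_pos, one_pos, one_pos, one_pos, fun i => i.elim⟩,
    ⟨1, 1, 1, 1, 1, one_pos, one_pos, one_pos, one_pos, one_pos, fun i => i.elim⟩,
    ⟨1, 1, 1, 1 / 2, one_pos, one_pos, one_pos, by norm_num, by norm_num, fun i => i.elim⟩⟩

/-- **N16 · NE3 carriers with `dom := ∅`** have `NE3EnergyRateWCov` vacuously (`∀ V ∈ ∅`), at ANY letters. [bookkeeping] -/
theorem n16At_emptyDom (L Nper : ℕ) (ε b g C Λ₁ Λ₂' : ℝ) : N16At (N := N) ⟨L, Nper, ε, b, g, C, Λ₁, Λ₂', ∅⟩ := by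
  intro _ _ V hV
  exact absurd hV (Set.notMem_empty V)

/-- **N18 · an EMPTY coupling window** makes NE5 vacuous at every member of run B's family (`∀ g ∈ ∅`).  ((D4) `ReadOutAt D u`, whose first clause puts
every box history into `u.W`, is NOT a conjunct of `RatesAt`.) [bookkeeping] -/
theorem n18At_of_window_eq_empty (u : U3Carriers) (hW : u.W = ∅) : N18At u := by
  intro b _ _ g hg
  rw [hW] at hg
  exact absurd hg (Set.notMem_empty g)

/-- **N22 · an EMPTY window and ZERO history moduli** make NE9 vacuous and fading memory trivial (`0 ≤ 0 ≤ C₉·ω^{k−i}` at `C₉ = 0`). [bookkeeping] -/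
theorem n22At_of_window_eq_empty (u : U3Carriers) (hW : u.W = ∅) (hΛ : u.Λ = fun _ _ => 0) (h9 : u.C₉ = 0) : N22At u := by
  refine ⟨fun g hg => ?_, fun k i _ => ?_⟩
  · rw [hW] at hg
    exact absurd hg (Set.notMem_empty g)
  · rw [hΛ, h9]
    exact ⟨le_rfl, (zero_mul _).ge⟩

end Degenerate

/-! ## §B ONE BUNDLE: `RatesAt` WITH A PINNED WINDOW IS N17 WITH FREE LETTERS -/

section OneBundle

variable {F : T4Family} {N : ℕ} [NeZero N]

/-- **THE LETTER-DEGENERATE RATE BUNDLE AT LETTERS `(γ, c, ρ)` CARRIES THE SIX RATES IFF N17 HOLDS AT `(c, ρ, γ)`**: carriers `ne1 :=` the empty tower,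
`ne2 :=` the empty index, `ne3 :=` `dom = ∅`, `u3 :=` the one-point output carriers with `W = ∅`, window `γ`, `θ = C₅ = 1`, `cr = c`, `ρ`, zero moduli — so
`RatesAt D R` reduces to its N17 conjunct `NE4OnData D (c·1·1) ρ γ`. [bookkeeping] -/
theorem ratesAt_degenerate_iff (D : Datum F N) (γ c ρ : ℝ) :
    RatesAt D
      { ne1 := ⟨Empty, ⟨fun q => q.elim, fun q => q.elim, fun q => q.elim⟩, 0⟩,
        ne2 := { I := PEmpty, c35 := 0, p := 0, pi := PEmpty.elim, Kop := fun i => i.elim, Ksite := fun i => i.elim, Kunit := fun i => i.elim,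
                 inΛ := fun i => i.elim, unitDist := fun i => i.elim },
        ne3 := ⟨0, 0, 0, 0, 0, 0, 0, 0, ∅⟩,
        u3 := { C := { Dom := Unit, scale := fun _ => 0, d := fun _ => 0, d_nonneg := fun _ => le_rfl, BgA := Unit, BgB := Unit,
                       gauge := fun _ _ => 0, gauge_nonneg := fun _ _ => le_rfl, transport := fun x => x },
                W := ∅, γ := γ, κ := 0, EA := fun _ _ _ => 0, EB := fun _ _ _ _ => 0, θ := 1, C₅ := 1, Λ := fun _ _ => 0, C₉ := 0, ω := 0,
                cr := c, ρ := ρ } } ↔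
      NE4OnData D c ρ γ := by
  refine ⟨fun h => ?_, fun h => ⟨n14At_emptyTower, n15At_emptyIndex, n16At_emptyDom 0 0 0 0 0 0 0 0, ?_,
    n18At_of_window_eq_empty _ rfl, n22At_of_window_eq_empty _ rfl rfl rfl⟩⟩
  · have h17 : NE4OnData D (c * 1 * 1) ρ γ := h.2.2.2.1
    simpa only [mul_one] using h17
  · show NE4OnData D (c * 1 * 1) ρ γ
    simpa only [mul_one] using h

/-- **SOME RATE BUNDLE WITH WINDOW `γ` ON WHICH `RatesAt` IS EXACTLY N17 AT `(c, ρ, γ)`** (the letter-degenerate one). [bookkeeping] -/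
theorem exists_rateCarriers_window_ratesAt_iff (D : Datum F N) (γ c ρ : ℝ) :
    ∃ R : RateCarriers N, R.u3.γ = γ ∧ (RatesAt D R ↔ NE4OnData D c ρ γ) :=
  ⟨_, rfl, ratesAt_degenerate_iff D γ c ρ⟩

/-- **`RatesAt` WITH THE WINDOW PINNED TO `γ` IS INHABITED IFF N17 HOLDS ON THE DATUM AT SOME FREE LETTERS `(c, ρ)` WITH WINDOW `γ`** (kernel):
`(∃ R, RatesAt D R ∧ R.u3.γ = γ) ↔ ∃ c ρ, NE4OnData D c ρ γ`.  (→) project the u3 letters `c := cr·C₅·θ`, `ρ`; (←) the letter-degenerate bundle.  No sign law and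
no `ρ < 1` survive: they live in (D4) `ReadOutAt` ∕ in N17's CONTENT theorems (`content_of_N17_datumOfRecord₁₂`), not in `RatesAt`. [bookkeeping] -/
theorem exists_ratesAt_window_iff_n17Free (D : Datum F N) (γ : ℝ) :
    (∃ R : RateCarriers N, RatesAt D R ∧ R.u3.γ = γ) ↔ ∃ c ρ : ℝ, NE4OnData D c ρ γ := by
  constructor
  · rintro ⟨R, hR, rfl⟩
    exact ⟨_, _, hR.2.2.2.1⟩
  · rintro ⟨c, ρ, h⟩
    exact ⟨_, (ratesAt_degenerate_iff D γ c ρ).2 h, rfl⟩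

/-- N17 PROPER (at given letters) implies the free form — the N17 content of stub 1 is AT MOST N17. [bookkeeping] -/
theorem n17Free_of_ne4OnData {D : Datum F N} {c ρ γ : ℝ} (h : NE4OnData D c ρ γ) : ∃ c ρ : ℝ, NE4OnData D c ρ γ :=
  ⟨c, ρ, h⟩

end OneBundle

/-! ## §C THE LITERAL SHAPE OF `stub_rates12` IS «N17 WITH FREE LETTERS AT THE RECORD» -/

section Keyed

variable {N : ℕ} [NeZero N]

/-- **STUB 1 OF K3′ v2, READ EXACTLY** (kernel `iff`, general `N`; the skeleton's `∃ rr : RateReading N, KeyedRates rr ∧ KeyedWindow rr` is the left-hand side by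
delta): SOME reading of rate carriers off the Stage-12 tuples carries the six rates on the datum of record at every admissible tuple, with the U3 window pinned to the
record's — IFF — at every admissible Stage-12 tuple with provisos the datum's β has SOME scale-shift bound with FREE letters on the record's own window:
`∀ F θ hP, θ.Admissible F N → ∃ c ρ, NE4OnData (datumOfRecord₁₂ F N θ hP) c ρ θ.γ`.  (→) evaluate the reading at `(g₀, os) := (0, [])` and project the u3 letters;
(←) choose letters per tuple (junk off admissibility) and read the letter-degenerate bundle — N14 ∕ N15 ∕ N16 ∕ N18 ∕ N22 contribute nothing. [bookkeeping] -/
theorem exists_keyedRatesWindow₁₂_iff_n17Free :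
    (∃ rr : (F : T4Family) → (θ : Stage12Params F N) → θ.Provisos₁₂ F N → (ℕ → ℝ) → List (ULoop F) → RateCarriers N,
        (∀ (F : T4Family) (θ : Stage12Params F N) (hP : θ.Provisos₁₂ F N), θ.Admissible F N → ∀ (g₀ : ℕ → ℝ) (os : List (ULoop F)),
            RatesAt (datumOfRecord₁₂ F N θ hP) (rr F θ hP g₀ os)) ∧
        (∀ (F : T4Family) (θ : Stage12Params F N) (hP : θ.Provisos₁₂ F N) (g₀ : ℕ → ℝ) (os : List (ULoop F)), (rr F θ hP g₀ os).u3.γ = θ.γ)) ↔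
      ∀ (F : T4Family) (θ : Stage12Params F N) (hP : θ.Provisos₁₂ F N), θ.Admissible F N →
        ∃ c ρ : ℝ, NE4OnData (datumOfRecord₁₂ F N θ hP) c ρ θ.γ := by
  constructor
  · rintro ⟨rr, hr, hw⟩ F θ hP hθ
    exact (exists_ratesAt_window_iff_n17Free _ _).1 ⟨rr F θ hP (fun _ => 0) [], hr F θ hP hθ _ _, hw F θ hP _ _⟩
  · intro h
    have hne : ∀ (F : T4Family) (θ : Stage12Params F N) (hP : θ.Provisos₁₂ F N),
        ∃ R : RateCarriers N, (θ.Admissible F N → RatesAt (datumOfRecord₁₂ F N θ hP) R) ∧ R.u3.γ = θ.γ := by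
      intro F θ hP
      rcases Classical.em (θ.Admissible F N) with hθ | hθ
      · obtain ⟨c, ρ, hc⟩ := h F θ hP hθ
        obtain ⟨R, hγ, hiff⟩ := exists_rateCarriers_window_ratesAt_iff (datumOfRecord₁₂ F N θ hP) θ.γ c ρ
        exact ⟨R, fun _ => hiff.2 hc, hγ⟩
      · obtain ⟨R, hγ, -⟩ := exists_rateCarriers_window_ratesAt_iff (datumOfRecord₁₂ F N θ hP) θ.γ 0 0
        exact ⟨R, fun h' => absurd h' hθ, hγ⟩
    choose R hR using hne
    exact ⟨fun F θ hP _ _ => R F θ hP, fun F θ hP hθ _ _ => (hR F θ hP).1 hθ, fun F θ hP _ _ => (hR F θ hP).2⟩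

end Keyed

/-! ## §D «N17 WITH FREE LETTERS AT THE RECORD» IN β-OF-RECORD WORDS -/

section BetaWords

variable {F : T4Family} {N : ℕ} [NeZero N]

/-- At a Stage-12 tuple with provisos: the free form ↔ the continuous-version MERGED β of record `βmT(θ)` has some scale-shift bound with free letters on the
record's own window `]0, θ.γ]` (companion 13's `N17_datumOfRecord₁₂_iff_merged` at `γ' = θ.γ`). [cite: Balaban1987RG1, (1.20)-(1.22) p.264] -/
theorem n17Free₁₂_iff_merged (θ : Stage12Params F N) (h : θ.Provisos₁₂ F N) :
    (∃ c ρ : ℝ, NE4OnData (datumOfRecord₁₂ F N θ h) c ρ θ.γ) ↔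
      ∃ c ρ : ℝ, letI := θ.instVβ₁; letI := θ.instVβ₂; letI := θ.instιβ
        ScaleShiftRate c ρ θ.γ (betaMerged F (mergedTermFamilyMatT F N (TcOfRecord F N) (chiFixed7 F N θ.ν) θ.εbg) θ.ρ8 θ.bV) :=
  exists_congr fun _ => exists_congr fun _ => N17_datumOfRecord₁₂_iff_merged θ h le_rfl

/-- The same at def-T's face `betaOfRecord₁₀ θ.toStage9Params` (`Iff.rfl`). [cite: Balaban1987RG1, (1.20)-(1.22) p.264] -/
theorem n17Free₁₂_iff_betaOfRecord₁₀ (θ : Stage12Params F N) (h : θ.Provisos₁₂ F N) :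
    (∃ c ρ : ℝ, NE4OnData (datumOfRecord₁₂ F N θ h) c ρ θ.γ) ↔
      ∃ c ρ : ℝ, ScaleShiftRate c ρ θ.γ (betaOfRecord₁₀ F N θ.toStage9Params) :=
  Iff.rfl

end BetaWords

/-! ## §E WHAT FREE LETTERS BUY: GROWTH, NOT DECAY -/

section Growth

/-- **ANY GEOMETRIC GROWTH BOUND GIVES THE FREE FORM**: if `|β_{k+1}(v)| ≤ M·A^k` on the boxes `]0, γ]^{k+1}` with `A ≥ 1`, `M ≥ 0`, then
`ScaleShiftRate (2MA) A γ β` — two triangle inequalities and `A^k ≤ A^{k+1}`; `Fin.tail` keeps a box history in the box.  So «N17 with free letters» is a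
statement about the SIZE of the record's β-functions, not about their η-DECAY (N17 proper has `ρ < 1`, under which `content_of_N17_datumOfRecord₁₂` extracts
(AF-0r)). [folklore] -/
theorem scaleShiftRate_of_absBound {β : HBeta} {M A γ : ℝ} (hM : 0 ≤ M) (hA : 1 ≤ A)
    (h : ∀ (k : ℕ) (v : Fin (k + 1) → ℝ), v ∈ Box γ k → |β k v| ≤ M * A ^ k) :
    ScaleShiftRate (2 * M * A) A γ β := by
  intro k w hw
  have htail : Fin.tail w ∈ Box γ k := mem_box.2 fun i => mem_box.1 hw i.succ
  have hpow : A ^ k ≤ A ^ (k + 1) := pow_le_pow_right₀ hA (Nat.le_succ k)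
  calc |β (k + 1) w - β k (Fin.tail w)| ≤ |β (k + 1) w| + |β k (Fin.tail w)| := abs_sub _ _
    _ ≤ M * A ^ (k + 1) + M * A ^ k := add_le_add (h _ _ hw) (h _ _ htail)
    _ ≤ M * A ^ (k + 1) + M * A ^ (k + 1) := add_le_add le_rfl (mul_le_mul_of_nonneg_left hpow hM)
    _ = 2 * M * A * A ^ k := by ring

end Growth

/-! ## §F GIVEN STUB 1, THE LITERAL SHAPE OF `stub_expansion12` NEVER READS THE RATES -/

section Expansion

variable {N : ℕ} [NeZero N]

/-- **STUB 2 OF K3′ v2 IS ITS RATE-FREE VERSION, GIVEN STUB 1's CONTENT** (kernel `iff`, general `N`; the three `rr`-free conjuncts `KeyedRelWeight` ∕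
`KeyedShellWeight` ∕ `KeyedExtraction` enter as arbitrary predicates `P₁ P₂ P₃` on spine readings, `KeyedCoreEdge cr rr` is written out): under «N17 with free letters at
the record», `(∀ rr, KeyedRates rr → KeyedWindow rr → ∃ cr, P₁ cr ∧ P₂ cr ∧ P₃ cr ∧ KeyedCoreEdge cr rr)` holds IFF `∃ cr, P₁ cr ∧ P₂ cr ∧ P₃ cr ∧` the NE7 core
two-run matching with some summable `δ` at every admissible tuple WITH NO RATE ANTECEDENT.  (→) instantiate the `∀ rr` at §C's letter-degenerate reading, whose
`RatesAt` antecedent is TRUE; (←) discard the antecedent.  The K4 letters a prover of stub 2 could use are erased by the `∀ rr`. [bookkeeping] -/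
theorem forall_keyedRates₁₂_imp_iff_rateFree
    (hfree : ∀ (F : T4Family) (θ : Stage12Params F N) (hP : θ.Provisos₁₂ F N), θ.Admissible F N →
      ∃ c ρ : ℝ, NE4OnData (datumOfRecord₁₂ F N θ hP) c ρ θ.γ)
    (P₁ P₂ P₃ : ((F : T4Family) → (θ : Stage12Params F N) → θ.Provisos₁₂ F N → (ℕ → ℝ) → List (ULoop F) → SpineCarriers) → Prop) :
    (∀ rr : (F : T4Family) → (θ : Stage12Params F N) → θ.Provisos₁₂ F N → (ℕ → ℝ) → List (ULoop F) → RateCarriers N,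
        (∀ (F : T4Family) (θ : Stage12Params F N) (hP : θ.Provisos₁₂ F N), θ.Admissible F N → ∀ (g₀ : ℕ → ℝ) (os : List (ULoop F)),
            RatesAt (datumOfRecord₁₂ F N θ hP) (rr F θ hP g₀ os)) →
        (∀ (F : T4Family) (θ : Stage12Params F N) (hP : θ.Provisos₁₂ F N) (g₀ : ℕ → ℝ) (os : List (ULoop F)), (rr F θ hP g₀ os).u3.γ = θ.γ) →
        ∃ cr : (F : T4Family) → (θ : Stage12Params F N) → θ.Provisos₁₂ F N → (ℕ → ℝ) → List (ULoop F) → SpineCarriers,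
          P₁ cr ∧ P₂ cr ∧ P₃ cr ∧
          ∀ (F : T4Family) (θ : Stage12Params F N) (hP : θ.Provisos₁₂ F N), θ.Admissible F N → ∀ (g₀ : ℕ → ℝ) (os : List (ULoop F)),
            RatesAt (datumOfRecord₁₂ F N θ hP) (rr F θ hP g₀ os) → letI := (cr F θ hP g₀ os).dec
              ∃ δ : ℕ → ℝ, NE7.Core (cr F θ hP g₀ os).l₀ (cr F θ hP g₀ os).vol (cr F θ hP g₀ os).T (cr F θ hP g₀ os).Bad
                (fun K t τ => (cr F θ hP g₀ os).A K t τ - (cr F θ hP g₀ os).shA K t τ)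
                (fun K t τ => (cr F θ hP g₀ os).B K t τ - (cr F θ hP g₀ os).shB K t τ) δ ∧ Summable δ) ↔
      ∃ cr : (F : T4Family) → (θ : Stage12Params F N) → θ.Provisos₁₂ F N → (ℕ → ℝ) → List (ULoop F) → SpineCarriers,
        P₁ cr ∧ P₂ cr ∧ P₃ cr ∧
        ∀ (F : T4Family) (θ : Stage12Params F N) (hP : θ.Provisos₁₂ F N), θ.Admissible F N → ∀ (g₀ : ℕ → ℝ) (os : List (ULoop F)),
          letI := (cr F θ hP g₀ os).dec
          ∃ δ : ℕ → ℝ, NE7.Core (cr F θ hP g₀ os).l₀ (cr F θ hP g₀ os).vol (cr F θ hP g₀ os).T (cr F θ hP g₀ os).Bad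
            (fun K t τ => (cr F θ hP g₀ os).A K t τ - (cr F θ hP g₀ os).shA K t τ)
            (fun K t τ => (cr F θ hP g₀ os).B K t τ - (cr F θ hP g₀ os).shB K t τ) δ ∧ Summable δ := by
  constructor
  · intro H
    obtain ⟨rr, hr, hw⟩ := (exists_keyedRatesWindow₁₂_iff_n17Free (N := N)).2 hfree
    obtain ⟨cr, h₁, h₂, h₃, hce⟩ := H rr hr hw
    exact ⟨cr, h₁, h₂, h₃, fun F θ hP hθ g₀ os => hce F θ hP hθ g₀ os (hr F θ hP hθ g₀ os)⟩
  · rintro ⟨cr, h₁, h₂, h₃, hcu⟩ rr _ _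
    exact ⟨cr, h₁, h₂, h₃, fun F θ hP hθ g₀ os _ => hcu F θ hP hθ g₀ os⟩

/-- **THE v2 CUT OF K3′ READ EXACTLY** (kernel `iff`, general `N`): `stub_rates12 ∧ stub_expansion12` (literal shapes; `P₁ P₂ P₃` := `KeyedRelWeight`,
`KeyedShellWeight`, `KeyedExtraction`) `↔` «N17 with free letters at the record» `∧ ∃ cr, P₁ cr ∧ P₂ cr ∧ P₃ cr ∧` the rate-free core matching — the K4 cluster
N14 ∕ N15 ∕ N16 ∕ N18 ∕ N22 is idle in the cut and N17 enters without `ρ < 1`.  Evidence for the planner; K3′ itself is neither claimed nor refuted. [bookkeeping] -/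
theorem k3Cut₁₂_iff_n17Free_and_rateFree
    (P₁ P₂ P₃ : ((F : T4Family) → (θ : Stage12Params F N) → θ.Provisos₁₂ F N → (ℕ → ℝ) → List (ULoop F) → SpineCarriers) → Prop) :
    ((∃ rr : (F : T4Family) → (θ : Stage12Params F N) → θ.Provisos₁₂ F N → (ℕ → ℝ) → List (ULoop F) → RateCarriers N,
        (∀ (F : T4Family) (θ : Stage12Params F N) (hP : θ.Provisos₁₂ F N), θ.Admissible F N → ∀ (g₀ : ℕ → ℝ) (os : List (ULoop F)),
            RatesAt (datumOfRecord₁₂ F N θ hP) (rr F θ hP g₀ os)) ∧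
        (∀ (F : T4Family) (θ : Stage12Params F N) (hP : θ.Provisos₁₂ F N) (g₀ : ℕ → ℝ) (os : List (ULoop F)), (rr F θ hP g₀ os).u3.γ = θ.γ)) ∧
      (∀ rr : (F : T4Family) → (θ : Stage12Params F N) → θ.Provisos₁₂ F N → (ℕ → ℝ) → List (ULoop F) → RateCarriers N,
        (∀ (F : T4Family) (θ : Stage12Params F N) (hP : θ.Provisos₁₂ F N), θ.Admissible F N → ∀ (g₀ : ℕ → ℝ) (os : List (ULoop F)),
            RatesAt (datumOfRecord₁₂ F N θ hP) (rr F θ hP g₀ os)) →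
        (∀ (F : T4Family) (θ : Stage12Params F N) (hP : θ.Provisos₁₂ F N) (g₀ : ℕ → ℝ) (os : List (ULoop F)), (rr F θ hP g₀ os).u3.γ = θ.γ) →
        ∃ cr : (F : T4Family) → (θ : Stage12Params F N) → θ.Provisos₁₂ F N → (ℕ → ℝ) → List (ULoop F) → SpineCarriers,
          P₁ cr ∧ P₂ cr ∧ P₃ cr ∧
          ∀ (F : T4Family) (θ : Stage12Params F N) (hP : θ.Provisos₁₂ F N), θ.Admissible F N → ∀ (g₀ : ℕ → ℝ) (os : List (ULoop F)),
            RatesAt (datumOfRecord₁₂ F N θ hP) (rr F θ hP g₀ os) → letI := (cr F θ hP g₀ os).dec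
              ∃ δ : ℕ → ℝ, NE7.Core (cr F θ hP g₀ os).l₀ (cr F θ hP g₀ os).vol (cr F θ hP g₀ os).T (cr F θ hP g₀ os).Bad
                (fun K t τ => (cr F θ hP g₀ os).A K t τ - (cr F θ hP g₀ os).shA K t τ)
                (fun K t τ => (cr F θ hP g₀ os).B K t τ - (cr F θ hP g₀ os).shB K t τ) δ ∧ Summable δ)) ↔
      (∀ (F : T4Family) (θ : Stage12Params F N) (hP : θ.Provisos₁₂ F N), θ.Admissible F N →
          ∃ c ρ : ℝ, NE4OnData (datumOfRecord₁₂ F N θ hP) c ρ θ.γ) ∧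
        ∃ cr : (F : T4Family) → (θ : Stage12Params F N) → θ.Provisos₁₂ F N → (ℕ → ℝ) → List (ULoop F) → SpineCarriers,
          P₁ cr ∧ P₂ cr ∧ P₃ cr ∧
          ∀ (F : T4Family) (θ : Stage12Params F N) (hP : θ.Provisos₁₂ F N), θ.Admissible F N → ∀ (g₀ : ℕ → ℝ) (os : List (ULoop F)),
            letI := (cr F θ hP g₀ os).dec
            ∃ δ : ℕ → ℝ, NE7.Core (cr F θ hP g₀ os).l₀ (cr F θ hP g₀ os).vol (cr F θ hP g₀ os).T (cr F θ hP g₀ os).Bad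
              (fun K t τ => (cr F θ hP g₀ os).A K t τ - (cr F θ hP g₀ os).shA K t τ)
              (fun K t τ => (cr F θ hP g₀ os).B K t τ - (cr F θ hP g₀ os).shB K t τ) δ ∧ Summable δ := by
  constructor
  · rintro ⟨h₁, h₂⟩
    have hfree := (exists_keyedRatesWindow₁₂_iff_n17Free (N := N)).1 h₁
    exact ⟨hfree, (forall_keyedRates₁₂_imp_iff_rateFree hfree P₁ P₂ P₃).1 h₂⟩
  · rintro ⟨hfree, h⟩
    exact ⟨(exists_keyedRatesWindow₁₂_iff_n17Free (N := N)).2 hfree, (forall_keyedRates₁₂_imp_iff_rateFree hfree P₁ P₂ P₃).2 h⟩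

end Expansion

end Summit.QuantumFields.YangMills.Theorems.BalabanUVNodesN17

end
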